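import Mathlib
import Literature.Analysis.FluidPDE.VorticityCalculus
import Summits.NavierStokesRegularity.NavierStokesRegularity.Theorems.ThreadingFluxHorizonTowerDefs
import Summits.NavierStokesRegularity.NavierStokesRegularity.Theorems.ThreadingFluxHorizonBlowdownJetCalculus
import Summits.NavierStokesRegularity.NavierStokesRegularity.Theorems.ThreadingFluxHorizonBlowdownScaling
import Summits.NavierStokesRegularity.NavierStokesRegularity.Theorems.ThreadingFluxHorizonBlowdownLoc2Scaling
import HarnessLib

/-!
# Crux `PoloidalLiouville` (stmt-NavierStokesRegularity-1222, W1), crux idea «horizon-threading-tower» (ns-idea-15):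
# the rescaled order-two balance in a blow-down limit (analytic core of `OrderTwoHorizonLawBlowdownReg` / `OrderTwoHorizonLaw`)

For a smooth slice `(w, q)`, a sequence of scales `λₖ → ∞` and constants `cₖ`, put `Wₖ(y) = w(x₀ + λₖ y)`,
`Qₖ(y) = q(x₀ + λₖ y) − cₖ`.  If at a point `z` the jets converge — `‖Dʲ(Wₖ − V)(z)‖ → 0` for `j ≤ 6` and
`‖Dʲ(Qₖ − Q)(z)‖ → 0` for `j ≤ 2`, with `V ∈ C⁶`, `Q ∈ C²` global — then the rescaled order-two balance converges:

`λₖ² · (Loc₂[w](x₀ + λₖ z) − ⟪curl w, ∇(radialVirial (head w q) x₀)⟫(x₀ + λₖ z))`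
`  ⟶ ⟪z, curl((V × curl V) × curl V) + curl(V × curl(V × curl V))⟫(z) − ⟪curl V z, ∇(radialVirial (head V Q) 0) z⟫`

(`OrderTwoBlowdown.tendsto_rescaled_loc2_sub_head`).  Ingredients: the affine rescaling identities `Scaling.loc2_affine`,
`Scaling.headTerm_affine` (layers (B), (C)) and the pointwise jet-convergence calculus `JetConv` (layer (A)): the `λₖ⁻¹`, `λₖ⁻²`
tails are convergent (hence bounded) jet polynomials times null sequences.  Both the blow-down law (window form, `∂ₜ²F ≡ 0`:
`ThreadingFluxHorizonOrderTwoLawBlowdown`) and the lever `OrderTwoHorizonLaw` (slice form with power tails) are read off from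
this one limit.  Helper theorem; no Prop of the sketch is restated; NS regularity is NOT proved by any of this.
-/

-- the summit and its single problem share the name (D-0017 nested layout)
set_option linter.dupNamespace false

noncomputable section

namespace Summit.NavierStokesRegularity.NavierStokesRegularity.Theorems.PoloidalLiouville.HorizonTower

open Set Function Filter Topology Metric
open scoped Topology RealInnerProductSpace Laplacian ContDiff
open Literature.Analysis.FluidPDE

/-- **RESCALED ORDER-TWO BALANCE IN THE BLOW-DOWN LIMIT** (the analytic core of the order-two horizon law).  Let `w`, `q` be a
smooth slice and pressure, `λₖ → ∞`, `cₖ` constants, and suppose that AT THE POINT `z` the rescaled fields `y ↦ w (x₀ + λₖ y)` converge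
to a global `C⁶` field `V` with six derivatives and `y ↦ q (x₀ + λₖ y) − cₖ` to a global `C²` function `Q` with two derivatives (the
pointwise jet-convergence shape of `JetConv`).  Then
`λₖ² · (Loc₂[w](x₀ + λₖ z) − ⟪curl w, ∇(radialVirial (head w q) x₀)⟫(x₀ + λₖ z))`
`⟶ ⟪z, curl((V × curl V) × curl V) + curl(V × curl(V × curl V))⟫(z) − ⟪curl V z, ∇(radialVirial (head V Q) 0) z⟫`:
by `Scaling.loc2_affine` / `Scaling.headTerm_affine` the `k`-th term is this bracket in the rescaled fields plus `λₖ⁻¹`, `λₖ⁻²`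
times jet polynomials that stay bounded (layer (A) `JetConv`), minus the rescaled head term (the constants `cₖ` do not change
gradients); every piece converges by `JetConv`. -/
theorem OrderTwoBlowdown.tendsto_rescaled_loc2_sub_head {w : E3 → E3} {q : E3 → ℝ} (hws : ContDiff ℝ (⊤ : ℕ∞) w)
    (hqs : ContDiff ℝ (⊤ : ℕ∞) q) (x₀ z : E3) {lam : ℕ → ℝ} (hlam : Tendsto lam atTop atTop) (c : ℕ → ℝ)
    {V : E3 → E3} {Q : E3 → ℝ} (hVC : ContDiff ℝ 6 V) (hQC : ContDiff ℝ 2 Q)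
    (hV6 : ∀ j ≤ 6, Tendsto (fun k => ‖iteratedFDeriv ℝ j (fun y => w (x₀ + lam k • y) - V y) z‖) atTop (𝓝 0))
    (hQ2 : ∀ j ≤ 2,
      Tendsto (fun k => ‖iteratedFDeriv ℝ j (fun y => (q (x₀ + lam k • y) - c k) - Q y) z‖) atTop (𝓝 0)) :
    Tendsto (fun k => (lam k) ^ 2 * (loc2 w x₀ (x₀ + lam k • z)
        - inner ℝ (curl w (x₀ + lam k • z)) (gradient (radialVirial (head w q) x₀) (x₀ + lam k • z)))) atTop
      (𝓝 (inner ℝ z (curl (fun y => cross (cross (V y) (curl V y)) (curl V y)) z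
          + curl (fun y => cross (V y) (curl (fun s => cross (V s) (curl V s)) y)) z)
        - inner ℝ (curl V z) (gradient (radialVirial (head V Q) 0) z))) := by
  have hlam_pos : ∀ᶠ k in atTop, 0 < lam k := hlam.eventually_gt_atTop 0
  have hlam_inv : Tendsto (fun k => (lam k)⁻¹) atTop (𝓝 0) := tendsto_inv_atTop_zero.comp hlam
  /- smoothness bookkeeping for the sequence and the cut-off limits -/
  have hWn : ∀ (n : ℕ) (k : ℕ), ContDiff ℝ n (fun y : E3 => w (x₀ + lam k • y)) := fun n k =>
    (Scaling.contDiff_comp_affine hws x₀ (lam k)).of_le (by exact_mod_cast le_top)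
  have hVn : ∀ n : ℕ, n ≤ 6 → ContDiff ℝ n V := fun n hn => hVC.of_le (by exact_mod_cast hn)
  have hQkn : ∀ (n : ℕ) (k : ℕ), ContDiff ℝ n (fun y : E3 => q (x₀ + lam k • y) - c k) := fun n k =>
    ((Scaling.contDiff_comp_affine hqs x₀ (lam k)).sub contDiff_const).of_le (by exact_mod_cast le_top)
  have hQn : ∀ n : ℕ, n ≤ 2 → ContDiff ℝ n Q := fun n hn => hQC.of_le (by exact_mod_cast hn)
  /- JET CONVERGENCE of the ingredients at `z` (layer (A)) -/
  -- velocity at order 5 and below, vorticity `Ω = curl W` at order 5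
  have hW5 : ∀ j ≤ 5, Tendsto (fun k => ‖iteratedFDeriv ℝ j (fun y => w (x₀ + lam k • y) - V y) z‖) atTop (𝓝 0) :=
    fun j hj => hV6 j (by omega)
  have hΩ5 := JetConv.curl_conv (m := 5) (hWn (5 + 1)) (hVn (5 + 1) (by norm_num)) (fun j hj => hV6 j (by omega))
  have hcurlVC : ∀ n : ℕ, n ≤ 5 → ContDiff ℝ n (curl V) := fun n hn =>
    (contDiff_curl (n := 5) (by exact_mod_cast hVn 6 le_rfl)).of_le (by exact_mod_cast hn)
  have hcurlWn : ∀ (n : ℕ) (k : ℕ), ContDiff ℝ n (curl (fun y : E3 => w (x₀ + lam k • y))) := fun n k =>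
    contDiff_curl (n := n) (by exact_mod_cast hWn (n + 1) k)
  -- `Λ = W × Ω` at order 5, `curl Λ` at order 4
  have hΛ5 := JetConv.cross_conv (m := 5) (hWn 5) (hVn 5 (by norm_num)) (hcurlWn 5) (hcurlVC 5 le_rfl) hW5 hΩ5
  have hΛC : ∀ n : ℕ, n ≤ 5 → ContDiff ℝ n (fun y => cross (V y) (curl V y)) := fun n hn =>
    Scaling.contDiff_cross_of (hVn n (by omega)) (hcurlVC n hn)
  have hΛkC : ∀ (n : ℕ) (k : ℕ), ContDiff ℝ n (fun y => cross (w (x₀ + lam k • y)) (curl (fun y : E3 => w (x₀ + lam k • y)) y)) :=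
    fun n k => Scaling.contDiff_cross_of (hWn n k) (hcurlWn n k)
  have hcΛ4 := JetConv.curl_conv (m := 4) (hΛkC (4 + 1)) (hΛC (4 + 1) (by norm_num)) hΛ5
  -- the horizon bracket: `curl(Λ × Ω)` and `curl(W × curl Λ)` at order 3
  have hΛ4 : ∀ j ≤ 4, _ := fun j (hj : j ≤ 4) => hΛ5 j (by omega)
  have hΩ4 : ∀ j ≤ 4, _ := fun j (hj : j ≤ 4) => hΩ5 j (by omega)
  have hW4 : ∀ j ≤ 4, _ := fun j (hj : j ≤ 4) => hW5 j (by omega)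
  have hF1 := JetConv.cross_conv (m := 4) (hΛkC 4) (hΛC 4 (by norm_num)) (hcurlWn 4) (hcurlVC 4 (by norm_num)) hΛ4 hΩ4
  have hcurlΛkC : ∀ (n : ℕ) (k : ℕ), ContDiff ℝ n
      (curl (fun y => cross (w (x₀ + lam k • y)) (curl (fun y : E3 => w (x₀ + lam k • y)) y))) := fun n k =>
    contDiff_curl (n := n) (by exact_mod_cast hΛkC (n + 1) k)
  have hcurlΛC : ∀ n : ℕ, n ≤ 4 → ContDiff ℝ n (curl (fun y => cross (V y) (curl V y))) := fun n hn =>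
    (contDiff_curl (n := 4) (by exact_mod_cast hΛC 5 le_rfl)).of_le (by exact_mod_cast hn)
  have hF2 := JetConv.cross_conv (m := 4) (hWn 4) (hVn 4 (by norm_num)) (hcurlΛkC 4) (hcurlΛC 4 le_rfl) hW4 hcΛ4
  have hF1C : ∀ (n : ℕ) (k : ℕ), ContDiff ℝ n (fun y => cross (cross (w (x₀ + lam k • y))
      (curl (fun y : E3 => w (x₀ + lam k • y)) y)) (curl (fun y : E3 => w (x₀ + lam k • y)) y)) :=
    fun n k => Scaling.contDiff_cross_of (hΛkC n k) (hcurlWn n k)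
  have hF1VC : ∀ n : ℕ, n ≤ 5 → ContDiff ℝ n (fun y => cross (cross (V y) (curl V y)) (curl V y)) := fun n hn =>
    Scaling.contDiff_cross_of (hΛC n hn) (hcurlVC n hn)
  have hF2C : ∀ (n : ℕ) (k : ℕ), ContDiff ℝ n (fun y => cross (w (x₀ + lam k • y))
      (curl (fun s => cross (w (x₀ + lam k • s)) (curl (fun y : E3 => w (x₀ + lam k • y)) s)) y)) :=
    fun n k => Scaling.contDiff_cross_of (hWn n k) (hcurlΛkC n k)
  have hF2VC : ∀ n : ℕ, n ≤ 4 → ContDiff ℝ n (fun y => cross (V y) (curl (fun s => cross (V s) (curl V s)) y)) :=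
    fun n hn => Scaling.contDiff_cross_of (hVn n (by omega)) (hcurlΛC n hn)
  have hcF1 := JetConv.curl_conv (m := 3) (hF1C (3 + 1)) (hF1VC (3 + 1) (by norm_num)) hF1
  have hcF2 := JetConv.curl_conv (m := 3) (hF2C (3 + 1)) (hF2VC (3 + 1) (by norm_num)) hF2
  have hT1 : Tendsto (fun k => inner ℝ z
        (curl (fun y => cross (cross (w (x₀ + lam k • y)) (curl (fun y : E3 => w (x₀ + lam k • y)) y))
            (curl (fun y : E3 => w (x₀ + lam k • y)) y)) z
          + curl (fun y => cross (w (x₀ + lam k • y))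
            (curl (fun s => cross (w (x₀ + lam k • s)) (curl (fun y : E3 => w (x₀ + lam k • y)) s)) y)) z)) atTop
      (𝓝 (inner ℝ z (curl (fun y => cross (cross (V y) (curl V y)) (curl V y)) z
          + curl (fun y => cross (V y) (curl (fun s => cross (V s) (curl V s)) y)) z))) :=
    tendsto_const_nhds.inner ((JetConv.tendsto_of_conv hcF1).add (JetConv.tendsto_of_conv hcF2))
  -- the viscous terms: `curl(ΔW × Ω)` (order 3), `curl(W × ΔΩ)` (order 2), `Δ curl Λ` (order 2), `Δ Δ Ω` (order 1)
  have hΔW := JetConv.laplacian_conv (m := 4) (hWn (4 + 2)) (hVn (4 + 2) (by norm_num)) (fun j hj => hV6 j (by omega))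
  have hΔWC : ∀ (n : ℕ) (k : ℕ), ContDiff ℝ n (Δ (fun y : E3 => w (x₀ + lam k • y))) := fun n k =>
    (Scaling.contDiff_laplacian (Scaling.contDiff_comp_affine hws x₀ (lam k))).of_le (by exact_mod_cast le_top)
  have hV'C : ContDiff ℝ 4 (Δ V) := by
    -- `Δ V` is `C⁴` for `V ∈ C⁶`: `Δ V = T ∘ D(DV)`
    set e : OrthonormalBasis (Fin 3) ℝ E3 := EuclideanSpace.basisFun (Fin 3) ℝ with he
    set T : (E3 →L[ℝ] E3 →L[ℝ] E3) →L[ℝ] E3 :=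
      ∑ i, (ContinuousLinearMap.apply ℝ E3 (e i)).comp (ContinuousLinearMap.apply ℝ (E3 →L[ℝ] E3) (e i)) with hT
    have hΔ : Δ V = fun y => T (fderiv ℝ (fderiv ℝ V) y) := by
      rw [InnerProductSpace.laplacian_eq_iteratedFDeriv_orthonormalBasis V e]
      funext y
      simp only [hT, sum_apply, ContinuousLinearMap.comp_apply, ContinuousLinearMap.apply_apply]
      exact Finset.sum_congr rfl fun i _ => by rw [iteratedFDeriv_two_apply]; rfl
    rw [hΔ]
    have h1 : ContDiff ℝ 5 (fderiv ℝ V) := (hVn 6 le_rfl).fderiv_right (m := 5) (by norm_cast)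
    have h2 : ContDiff ℝ 4 (fderiv ℝ (fderiv ℝ V)) := h1.fderiv_right (m := 4) (by norm_cast)
    exact T.contDiff.comp h2
  have hΔVn : ∀ n : ℕ, n ≤ 4 → ContDiff ℝ n (Δ V) := fun n hn => hV'C.of_le (by exact_mod_cast hn)
  -- curl(ΔW × Ω): order 3
  have hΔW4 : ∀ j ≤ 4, _ := fun j (hj : j ≤ 4) => hΔW j hj
  have hX1 := JetConv.cross_conv (m := 4) (hΔWC 4) (hΔVn 4 le_rfl) (hcurlWn 4) (hcurlVC 4 (by norm_num)) hΔW4 hΩ4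
  have hX1C : ∀ (n : ℕ) (k : ℕ), ContDiff ℝ n (fun y => cross ((Δ (fun y : E3 => w (x₀ + lam k • y))) y)
      (curl (fun y : E3 => w (x₀ + lam k • y)) y)) := fun n k => Scaling.contDiff_cross_of (hΔWC n k) (hcurlWn n k)
  have hX1VC : ∀ n : ℕ, n ≤ 4 → ContDiff ℝ n (fun y => cross ((Δ V) y) (curl V y)) := fun n hn =>
    Scaling.contDiff_cross_of (hΔVn n hn) (hcurlVC n (by omega))
  have hcX1 := JetConv.curl_conv (m := 3) (hX1C (3 + 1)) (hX1VC (3 + 1) (by norm_num)) hX1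
  -- curl(W × ΔΩ): order 2
  have hΔΩ := JetConv.laplacian_conv (m := 3) (hcurlWn (3 + 2)) (hcurlVC (3 + 2) (by norm_num)) hΩ5
  have hΔΩC : ∀ (n : ℕ) (k : ℕ), ContDiff ℝ n (Δ (curl (fun y : E3 => w (x₀ + lam k • y)))) := fun n k =>
    (Scaling.contDiff_laplacian (Scaling.contDiff_curl_top (Scaling.contDiff_comp_affine hws x₀ (lam k)))).of_le
      (by exact_mod_cast le_top)
  have hV''C : ContDiff ℝ 3 (Δ (curl V)) := by
    set e : OrthonormalBasis (Fin 3) ℝ E3 := EuclideanSpace.basisFun (Fin 3) ℝ with he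
    set T : (E3 →L[ℝ] E3 →L[ℝ] E3) →L[ℝ] E3 :=
      ∑ i, (ContinuousLinearMap.apply ℝ E3 (e i)).comp (ContinuousLinearMap.apply ℝ (E3 →L[ℝ] E3) (e i)) with hT
    have hΔ : Δ (curl V) = fun y => T (fderiv ℝ (fderiv ℝ (curl V)) y) := by
      rw [InnerProductSpace.laplacian_eq_iteratedFDeriv_orthonormalBasis (curl V) e]
      funext y
      simp only [hT, sum_apply, ContinuousLinearMap.comp_apply, ContinuousLinearMap.apply_apply]
      exact Finset.sum_congr rfl fun i _ => by rw [iteratedFDeriv_two_apply]; rfl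
    rw [hΔ]
    have h1 : ContDiff ℝ 4 (fderiv ℝ (curl V)) := (hcurlVC 5 le_rfl).fderiv_right (m := 4) (by norm_cast)
    have h2 : ContDiff ℝ 3 (fderiv ℝ (fderiv ℝ (curl V))) := h1.fderiv_right (m := 3) (by norm_cast)
    exact T.contDiff.comp h2
  have hΔΩVn : ∀ n : ℕ, n ≤ 3 → ContDiff ℝ n (Δ (curl V)) := fun n hn => hV''C.of_le (by exact_mod_cast hn)
  have hW3 : ∀ j ≤ 3, _ := fun j (hj : j ≤ 3) => hW5 j (by omega)
  have hX2 := JetConv.cross_conv (m := 3) (hWn 3) (hVn 3 (by norm_num)) (hΔΩC 3) (hΔΩVn 3 le_rfl) hW3 hΔΩ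
  have hX2C : ∀ (n : ℕ) (k : ℕ), ContDiff ℝ n (fun y => cross (w (x₀ + lam k • y))
      ((Δ (curl (fun y : E3 => w (x₀ + lam k • y)))) y)) := fun n k => Scaling.contDiff_cross_of (hWn n k) (hΔΩC n k)
  have hX2VC : ∀ n : ℕ, n ≤ 3 → ContDiff ℝ n (fun y => cross (V y) ((Δ (curl V)) y)) := fun n hn =>
    Scaling.contDiff_cross_of (hVn n (by omega)) (hΔΩVn n hn)
  have hcX2 := JetConv.curl_conv (m := 2) (hX2C (2 + 1)) (hX2VC (2 + 1) (by norm_num)) hX2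
  -- Δ curl Λ: order 2;  Δ Δ Ω: order 1
  have hΔcΛ := JetConv.laplacian_conv (m := 2) (hcurlΛkC (2 + 2)) (hcurlΛC (2 + 2) le_rfl) hcΛ4
  have hΔΔΩ := JetConv.laplacian_conv (m := 1) (hΔΩC (1 + 2)) (hΔΩVn (1 + 2) le_rfl) hΔΩ
  have hT2 : Tendsto (fun k => inner ℝ z
        (curl (fun y => cross ((Δ (fun y : E3 => w (x₀ + lam k • y))) y) (curl (fun y : E3 => w (x₀ + lam k • y)) y)) z
          + curl (fun y => cross (w (x₀ + lam k • y)) ((Δ (curl (fun y : E3 => w (x₀ + lam k • y)))) y)) z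
          + (Δ (curl (fun s => cross (w (x₀ + lam k • s)) (curl (fun y : E3 => w (x₀ + lam k • y)) s)))) z)) atTop
      (𝓝 (inner ℝ z (curl (fun y => cross ((Δ V) y) (curl V y)) z + curl (fun y => cross (V y) ((Δ (curl V)) y)) z
          + (Δ (curl (fun s => cross (V s) (curl V s)))) z))) :=
    tendsto_const_nhds.inner (((JetConv.tendsto_of_conv hcX1).add (JetConv.tendsto_of_conv hcX2)).add
      (JetConv.tendsto_of_conv hΔcΛ))
  have hT3 : Tendsto (fun k => inner ℝ z ((Δ (Δ (curl (fun y : E3 => w (x₀ + lam k • y))))) z)) atTop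
      (𝓝 (inner ℝ z ((Δ (Δ (curl V))) z))) := tendsto_const_nhds.inner (JetConv.tendsto_of_conv hΔΔΩ)
  /- the head term: `⟪curl Wₖ z, ∇(radialVirial (head Wₖ Qₖ) 0)(z)⟫ → ⟪curl V z, ∇(radialVirial (head V Q) 0)(z)⟫` -/
  have hW2 : ∀ j ≤ 2, _ := fun j (hj : j ≤ 2) => hV6 j (by omega)
  -- `‖W‖²/2 = ½⟪W, W⟫` at order 2, hence the heads at order 2
  have hsq := JetConv.bilinear_conv (m := 2) (innerSL ℝ (E := E3)) (hWn 2) (hVn 2 (by norm_num)) (hWn 2) (hVn 2 (by norm_num))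
    hW2 hW2
  have hsqC : ∀ (n : ℕ) (k : ℕ), ContDiff ℝ n (fun y => (innerSL ℝ (E := E3)) (w (x₀ + lam k • y)) (w (x₀ + lam k • y))) :=
    fun n k => (innerSL ℝ (E := E3)).isBoundedBilinearMap.contDiff.comp ((hWn n k).prodMk (hWn n k))
  have hsqVC : ∀ n : ℕ, n ≤ 6 → ContDiff ℝ n (fun y => (innerSL ℝ (E := E3)) (V y) (V y)) := fun n hn =>
    (innerSL ℝ (E := E3)).isBoundedBilinearMap.contDiff.comp ((hVn n hn).prodMk (hVn n hn))
  have hhalf := JetConv.const_smul_conv (1 / 2 : ℝ) (m := 2) (hsqC 2) (hsqVC 2 (by norm_num)) hsq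
  have hhead := JetConv.add_conv (m := 2) (hQkn 2) (hQn 2 le_rfl) (fun k => (hsqC 2 k).const_smul (1 / 2 : ℝ))
    ((hsqVC 2 (by norm_num)).const_smul (1 / 2 : ℝ)) hQ2 hhalf
  -- identify with `head`
  have hheadW : ∀ k, (fun y => (q (x₀ + lam k • y) - c k) + (1 / 2 : ℝ) • (innerSL ℝ (E := E3)) (w (x₀ + lam k • y)) (w (x₀ + lam k • y)))
      = head (fun y : E3 => w (x₀ + lam k • y)) (fun y => q (x₀ + lam k • y) - c k) := by
    intro k; funext y
    simp only [head, innerSL_apply_apply, real_inner_self_eq_norm_sq, smul_eq_mul]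
    ring
  have hheadV : (fun y => Q y + (1 / 2 : ℝ) • (innerSL ℝ (E := E3)) (V y) (V y)) = head V Q := by
    funext y
    simp only [head, innerSL_apply_apply, real_inner_self_eq_norm_sq, smul_eq_mul]
    ring
  have hheadC : ∀ (n : ℕ), n ≤ 2 → ∀ k : ℕ, ContDiff ℝ n (head (fun y : E3 => w (x₀ + lam k • y)) (fun y => q (x₀ + lam k • y) - c k)) :=
    fun n hn k => by rw [← hheadW k]; exact ((hQkn n k).add ((hsqC n k).const_smul _))
  have hheadVC : ∀ n : ℕ, n ≤ 2 → ContDiff ℝ n (head V Q) := fun n hn => by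
    rw [← hheadV]; exact (hQn n hn).add ((hsqVC n (by omega)).const_smul _)
  have hhead2 : ∀ j ≤ 2, Tendsto (fun k => ‖iteratedFDeriv ℝ j (fun y =>
      head (fun y : E3 => w (x₀ + lam k • y)) (fun y => q (x₀ + lam k • y) - c k) y - head V Q y) z‖) atTop (𝓝 0) := by
    intro j hj
    have h := hhead j hj
    simpa only [← hheadW, ← hheadV] using h
  -- gradient of the head: order 1
  have hDhead := JetConv.fderiv_conv (m := 1) (hheadC (1 + 1) (by norm_num)) (hheadVC (1 + 1) (by norm_num)) hhead2
  have hgradhead := JetConv.clm_conv ((InnerProductSpace.toDual ℝ E3).symm : (E3 →L[ℝ] ℝ) →L[ℝ] E3) (m := 1)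
    (fun k => (hheadC 2 le_rfl k).fderiv_right (m := 1) (by norm_cast))
    ((hheadVC 2 le_rfl).fderiv_right (m := 1) (by norm_cast)) hDhead
  -- radial virial `⟪y − 0, ∇head y⟫`: order 1 (the first factor is the constant sequence `y ↦ y − 0`)
  have hidC : ContDiff ℝ 1 (fun y : E3 => y - 0) := contDiff_id.sub contDiff_const
  have hid1 : ∀ j ≤ 1, Tendsto (fun k : ℕ => ‖iteratedFDeriv ℝ j (fun y : E3 => (y - 0) - (y - 0)) z‖) atTop (𝓝 0) := by
    intro j hj
    have h0 : (fun y : E3 => (y - 0) - (y - 0)) = (0 : E3 → E3) := by funext y; simp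
    have h1 : iteratedFDeriv ℝ j (fun y : E3 => (y - 0) - (y - 0)) z = 0 := by
      rw [h0]; simp
    simp only [h1, norm_zero]
    exact tendsto_const_nhds
  have hgradC : ∀ k, ContDiff ℝ 1 (fun y => ((InnerProductSpace.toDual ℝ E3).symm : (E3 →L[ℝ] ℝ) →L[ℝ] E3)
      (fderiv ℝ (head (fun y : E3 => w (x₀ + lam k • y)) (fun y => q (x₀ + lam k • y) - c k)) y)) := fun k =>
    ((InnerProductSpace.toDual ℝ E3).symm : (E3 →L[ℝ] ℝ) →L[ℝ] E3).contDiff.comp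
      ((hheadC 2 le_rfl k).fderiv_right (m := 1) (by norm_cast))
  have hgradVC : ContDiff ℝ 1 (fun y => ((InnerProductSpace.toDual ℝ E3).symm : (E3 →L[ℝ] ℝ) →L[ℝ] E3)
      (fderiv ℝ (head V Q) y)) :=
    ((InnerProductSpace.toDual ℝ E3).symm : (E3 →L[ℝ] ℝ) →L[ℝ] E3).contDiff.comp
      ((hheadVC 2 le_rfl).fderiv_right (m := 1) (by norm_cast))
  have hRV := JetConv.bilinear_conv (m := 1) (innerSL ℝ (E := E3)) (fun _ => hidC) hidC hgradC hgradVC hid1 hgradhead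
  -- identify with `radialVirial`
  have hRVW : ∀ k, (fun y => (innerSL ℝ (E := E3)) (y - 0) (((InnerProductSpace.toDual ℝ E3).symm : (E3 →L[ℝ] ℝ) →L[ℝ] E3)
      (fderiv ℝ (head (fun y : E3 => w (x₀ + lam k • y)) (fun y => q (x₀ + lam k • y) - c k)) y)))
      = radialVirial (head (fun y : E3 => w (x₀ + lam k • y)) (fun y => q (x₀ + lam k • y) - c k)) 0 := by
    intro k; funext y; simp only [radialVirial, innerSL_apply_apply, gradient]; rfl
  have hRVV : (fun y => (innerSL ℝ (E := E3)) (y - 0) (((InnerProductSpace.toDual ℝ E3).symm : (E3 →L[ℝ] ℝ) →L[ℝ] E3)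
      (fderiv ℝ (head V Q) y))) = radialVirial (head V Q) 0 := by
    funext y; simp only [radialVirial, innerSL_apply_apply, gradient]; rfl
  have hRC : ∀ k, ContDiff ℝ 1 (radialVirial (head (fun y : E3 => w (x₀ + lam k • y)) (fun y => q (x₀ + lam k • y) - c k)) 0) :=
    fun k => by unfold radialVirial; exact hidC.inner ℝ (hgradC k)
  have hRVC' : ContDiff ℝ 1 (radialVirial (head V Q) 0) := by
    unfold radialVirial; exact hidC.inner ℝ hgradVC
  have hR1 : ∀ j ≤ 1, Tendsto (fun k => ‖iteratedFDeriv ℝ j (fun y =>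
      radialVirial (head (fun y : E3 => w (x₀ + lam k • y)) (fun y => q (x₀ + lam k • y) - c k)) 0 y
        - radialVirial (head V Q) 0 y) z‖) atTop (𝓝 0) := by
    intro j hj
    have h := hRV j hj
    simpa only [← hRVW, ← hRVV] using h
  have hDR := JetConv.fderiv_conv (m := 0) hRC hRVC' hR1
  have hgradR := JetConv.clm_conv ((InnerProductSpace.toDual ℝ E3).symm : (E3 →L[ℝ] ℝ) →L[ℝ] E3) (m := 0)
    (fun k => (hRC k).fderiv_right (m := 0) (by norm_cast)) (hRVC'.fderiv_right (m := 0) (by norm_cast)) hDR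
  have hgradRlim : Tendsto (fun k => gradient (radialVirial (head (fun y : E3 => w (x₀ + lam k • y))
      (fun y => q (x₀ + lam k • y) - c k)) 0) z) atTop (𝓝 (gradient (radialVirial (head V Q) 0) z)) := by
    have h := JetConv.tendsto_of_conv hgradR
    exact h
  have hcurllim : Tendsto (fun k => curl (fun y : E3 => w (x₀ + lam k • y)) z) atTop (𝓝 (curl V z)) :=
    JetConv.tendsto_of_conv hΩ5
  have hT4 : Tendsto (fun k => inner ℝ (curl (fun y : E3 => w (x₀ + lam k • y)) z)
      (gradient (radialVirial (head (fun y : E3 => w (x₀ + lam k • y)) (fun y => q (x₀ + lam k • y) - c k)) 0) z)) atTop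
      (𝓝 (inner ℝ (curl V z) (gradient (radialVirial (head V Q) 0) z))) := hcurllim.inner hgradRlim
  /- Step 2: the rescaled identity for every `k` with `λₖ > 0` (layers (B), (C)) -/
  have hEk : ∀ᶠ k in atTop,
      (lam k) ^ 2 * (loc2 w x₀ (x₀ + lam k • z)
          - inner ℝ (curl w (x₀ + lam k • z)) (gradient (radialVirial (head w q) x₀) (x₀ + lam k • z)))
        = (inner ℝ z
          (curl (fun y => cross (cross (w (x₀ + lam k • y)) (curl (fun y => w (x₀ + lam k • y)) y))
              (curl (fun y => w (x₀ + lam k • y)) y)) z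
            + curl (fun y => cross (w (x₀ + lam k • y))
              (curl (fun s => cross (w (x₀ + lam k • s)) (curl (fun y => w (x₀ + lam k • y)) s)) y)) z)
        + (lam k)⁻¹ * inner ℝ z
          (curl (fun y => cross ((Δ (fun y => w (x₀ + lam k • y))) y) (curl (fun y => w (x₀ + lam k • y)) y)) z
            + curl (fun y => cross (w (x₀ + lam k • y)) ((Δ (curl (fun y => w (x₀ + lam k • y)))) y)) z
            + (Δ (curl (fun s => cross (w (x₀ + lam k • s)) (curl (fun y => w (x₀ + lam k • y)) s)))) z)
        + ((lam k)⁻¹) ^ 2 * inner ℝ z ((Δ (Δ (curl (fun y => w (x₀ + lam k • y))))) z))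
        - inner ℝ (curl (fun y : E3 => w (x₀ + lam k • y)) z)
          (gradient (radialVirial (head (fun y : E3 => w (x₀ + lam k • y)) (fun y => q (x₀ + lam k • y) - c k)) 0) z) := by
    filter_upwards [hlam_pos] with k hk
    have h1 := Scaling.loc2_affine hws x₀ hk.ne' z
    have h2 := Scaling.headTerm_affine (q := q) hws (hqs.of_le (by norm_cast)) x₀ hk.ne' z
    have hRconst : radialVirial (head (fun y : E3 => w (x₀ + lam k • y)) (fun y => q (x₀ + lam k • y) - c k)) 0
        = radialVirial (head (fun y : E3 => w (x₀ + lam k • y)) (fun y => q (x₀ + lam k • y))) 0 := by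
      funext y
      unfold radialVirial
      congr 1
      have hh : head (fun y : E3 => w (x₀ + lam k • y)) (fun y => q (x₀ + lam k • y) - c k)
          = fun y => head (fun y : E3 => w (x₀ + lam k • y)) (fun y => q (x₀ + lam k • y)) y - c k := by
        funext y'; simp only [head]; ring
      rw [hh, gradient, gradient, fderiv_sub_const]
    rw [hRconst, mul_sub, h1, h2]
    have hne : lam k ≠ 0 := hk.ne'
    congr 1
    field_simp
  /- Step 3: pass to the limit -/
  have hLHS := ((hT1.add (hlam_inv.mul hT2)).add ((hlam_inv.pow 2).mul hT3)).sub hT4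
  rw [zero_pow two_ne_zero, zero_mul, zero_mul, add_zero, add_zero] at hLHS
  exact hLHS.congr' (hEk.mono fun k hk => hk.symm)

end Summit.NavierStokesRegularity.NavierStokesRegularity.Theorems.PoloidalLiouville.HorizonTower

end
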